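import Literature.Probability.LatticeModels.LatticeGreenDimensionMonotone
import HarnessLib

/-!
# `1 ≤ d R(d) ≤ d/(d-2)`: the infrared constant times the dimension tends to one
# (Salmhofer–Seiler 1991, Appendix (A.7), (A.23), (A.24), (A.59))

Topic `Probability/LatticeModels`, namespace `Literature.Probability.LatticeModels`; a short
companion of `LatticeGreenOriginBound.lean` (`R(d) ≤ 1/(d - 2)`, Salmhofer–Seiler's Lemma A.4) and
`LatticeGreenDimensionMonotone.lean` (`d R(d)` non-increasing, Prop. A.6; (A.7) for real `ν`).
Here `R(d) = latticeGreen (0 : Site d) = ∫ d^dk/((2π)^d Σ_μ(1 - cos k_μ))` and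
`r(x) = srwHeatKernel x 0 = (1/2π)∫_{-π}^{π} e^{-x(1 - cos k)} dk = I₀(x)e^{-x}`.  PROVED (theorems
only, no definition, no named fact):

* `exp_neg_le_srwHeatKernel_zero` — `e^{-x} ≤ r(x)`, i.e. `I₀(x) ≥ 1` (Jensen for the convex
  exponential on the average (A.24), `⨍(1 - cos k) dk = 1`);
* `inv_le_integral_srwHeatKernel_zero_rpow` — `1/ν ≤ ∫₀^∞ r(t)^ν dt` for real `ν > 2`
  (`r(t)^ν ≥ e^{-νt}`); `one_le_dim_mul_latticeGreen_zero` — **`1 ≤ d R(d)`** (`d ≥ 3`);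
* **`tendsto_dim_mul_latticeGreen_zero`** — **`d R(d) → 1`** as `d → ∞`, by the squeeze
  `1 ≤ dR(d) ≤ d/(d - 2)` ((A.23); the limit `ν/(ν-2) → 1` is the one used in (A.59)).

In random-walk language `d R(d) = G_d(0,0)` is the expected number of visits of simple random walk on
`ℤ^d` to its starting point, which is `≥ 1` and tends to `1` in high dimension (Pólya); for the
infrared bound, `R(d) = 1/d + O(1/d²)`.

## References

* M. Salmhofer, E. Seiler, Commun. Math. Phys. 139 (1991) 395–432, Appendix (A.7), Lemma A.4
  (A.22)–(A.24), (A.59). [SalmhoferSeiler1991]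

## Mathlib

`ConvexOn.map_set_average_le` with `convexOn_exp` (Jensen), `integral_cos`,
`tendsto_of_tendsto_of_tendsto_of_le_of_le'`, `Filter.Tendsto.div_atTop`.
-/

noncomputable section

open MeasureTheory Set Filter Real
open scoped Topology

namespace Literature.Probability.LatticeModels

variable {d : ℕ}

/-- **`r(x) ≥ e^{-x}`** (`I₀(x) ≥ 1`): Jensen's inequality for the convex exponential and the
average `r(x) = ⨍_{[-π,π]} e^{-x(1 - cos k)} dk`, `⨍(1 - cos k) = 1`.
[cite: SalmhoferSeiler1991, (A.24) (`r = I₀e^{-x}`, `I₀ ≥ 1`)] -/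
theorem exp_neg_le_srwHeatKernel_zero (x : ℝ) : Real.exp (-x) ≤ srwHeatKernel x 0 := by
  have hle : (-π : ℝ) ≤ π := by linarith [Real.pi_pos]
  set f : ℝ → ℝ := fun k => -(x * (1 - Real.cos k)) with hf
  have hfc : Continuous f := by simp only [hf]; fun_prop
  have hgc : Continuous fun k => Real.exp (f k) := Real.continuous_exp.comp hfc
  have hvol : (volume : Measure ℝ).real (Ioc (-π) π) = 2 * π := by
    rw [Real.volume_real_Ioc_of_le hle]; ring
  have h0vol : (volume : Measure ℝ) (Ioc (-π) π) ≠ 0 := by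
    rw [Real.volume_Ioc]
    have : (0 : ℝ) < π - -π := by linarith [Real.pi_pos]
    simpa using this
  have htop : (volume : Measure ℝ) (Ioc (-π) π) ≠ ⊤ := by
    rw [Real.volume_Ioc]; exact ENNReal.ofReal_ne_top
  -- `⨍ f = -x` (since `∫_{-π}^{π} cos = 0`)
  have hint_f : ∫ k in Ioc (-π) π, f k = -x * (2 * π) := by
    rw [← intervalIntegral.integral_of_le hle]
    simp only [hf]
    rw [intervalIntegral.integral_neg, intervalIntegral.integral_const_mul,
      intervalIntegral.integral_sub intervalIntegrable_const (Real.continuous_cos.intervalIntegrable _ _),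
      intervalIntegral.integral_const, integral_cos, Real.sin_neg, Real.sin_pi]
    simp only [smul_eq_mul, mul_one, neg_zero, sub_zero]
    ring
  have havg_f : ⨍ k in Ioc (-π) π, f k = -x := by
    rw [setAverage_eq, hvol, hint_f, smul_eq_mul]
    field_simp
  have havg_g : ⨍ k in Ioc (-π) π, Real.exp (f k) = srwHeatKernel x 0 := by
    rw [setAverage_eq, hvol, srwHeatKernel_zero_eq, intervalIntegral.integral_of_le hle,
      smul_eq_mul]
    simp only [hf]
    ring
  have hJ := (convexOn_exp).map_set_average_le Real.continuous_exp.continuousOn isClosed_univ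
    h0vol htop (Eventually.of_forall fun k => Set.mem_univ _)
    (hfc.integrableOn_Ioc) (hgc.integrableOn_Ioc)
  rw [havg_f, havg_g] at hJ
  exact hJ

/-- **`ν R(ν) ≥ 1`** for real `ν > 2`: `∫₀^∞ r(t)^ν dt ≥ ∫₀^∞ e^{-νt} dt = 1/ν`.  (In random-walk
terms: the expected number of visits of simple random walk to its starting point is at least one.)
[cite: SalmhoferSeiler1991, (A.7) with (A.24)] -/
theorem inv_le_integral_srwHeatKernel_zero_rpow {ν : ℝ} (hν : 2 < ν) :
    1 / ν ≤ ∫ t in Ioi (0 : ℝ), srwHeatKernel t 0 ^ ν := by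
  have hν0 : 0 < ν := by linarith
  obtain ⟨hint_e, hval⟩ := integral_exp_neg_mul_Ioi' hν0
  rw [one_div, ← hval]
  refine setIntegral_mono_on hint_e (integrableOn_srwHeatKernel_zero_rpow hν).1 measurableSet_Ioi
    fun t _ => ?_
  calc Real.exp (-(t * ν)) = Real.exp (-t) ^ ν := by
        rw [← Real.exp_mul]; ring_nf
    _ ≤ srwHeatKernel t 0 ^ ν :=
        Real.rpow_le_rpow (Real.exp_pos _).le (exp_neg_le_srwHeatKernel_zero t) hν0.le

/-- **`1 ≤ d R(d)`** on the lattice (`d ≥ 3`): `G_d(0,0) ≥ 1`. [cite: SalmhoferSeiler1991, (A.7) with (A.24)] -/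
theorem one_le_dim_mul_latticeGreen_zero (hd : 3 ≤ d) :
    1 ≤ (d : ℝ) * latticeGreen (0 : Site d) := by
  have hd' : (2 : ℝ) < d := by exact_mod_cast (show 2 < d by omega)
  have hd0 : (0 : ℝ) < d := by linarith
  have h := inv_le_integral_srwHeatKernel_zero_rpow hd'
  rw [latticeGreen_zero_eq_integral_rpow hd]
  rw [div_le_iff₀' hd0] at h
  exact h

/-- **`d R(d) → 1` as `d → ∞`**: `1 ≤ dR(d) ≤ d/(d - 2)` (Lemma A.4 (A.23)); the Green function of
simple random walk at the origin tends to one in high dimension (Pólya), equivalently the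
Fröhlich–Simon–Spencer infrared constant is `R(d) = 1/d + O(1/d²)`. [cite: SalmhoferSeiler1991, (A.23) and (A.59) (`ν/(ν-2) → 1`)] -/
theorem tendsto_dim_mul_latticeGreen_zero :
    Tendsto (fun d : ℕ => (d : ℝ) * latticeGreen (0 : Site d)) atTop (𝓝 1) := by
  have hup : Tendsto (fun d : ℕ => (d : ℝ) / ((d : ℝ) - 2)) atTop (𝓝 1) := by
    have h1 : Tendsto (fun d : ℕ => 1 + 2 / ((d : ℝ) - 2)) atTop (𝓝 (1 + 0)) :=
      tendsto_const_nhds.add (tendsto_const_nhds.div_atTop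
        (tendsto_atTop_add_const_right _ _ tendsto_natCast_atTop_atTop))
    rw [add_zero] at h1
    refine h1.congr' ?_
    filter_upwards [eventually_ge_atTop 3] with d hd
    have hd' : (3 : ℝ) ≤ d := by exact_mod_cast hd
    have hne : (d : ℝ) - 2 ≠ 0 := by linarith
    field_simp
    ring
  refine tendsto_of_tendsto_of_tendsto_of_le_of_le' tendsto_const_nhds hup ?_ ?_
  · filter_upwards [eventually_ge_atTop 3] with d hd using one_le_dim_mul_latticeGreen_zero hd
  · filter_upwards [eventually_ge_atTop 3] with d hd
    have h := latticeGreen_zero_le_inv_sub_two (d := d) hd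
    have hd0 : (0 : ℝ) ≤ d := Nat.cast_nonneg d
    calc (d : ℝ) * latticeGreen (0 : Site d) ≤ d * (1 / ((d : ℝ) - 2)) :=
          mul_le_mul_of_nonneg_left h hd0
      _ = (d : ℝ) / ((d : ℝ) - 2) := by rw [mul_one_div]

end Literature.Probability.LatticeModels

end
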